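import Mathlib
import Literature.NumberTheory.GaloisRepresentations.PseudocharacterTaylorProofs
import Literature.NumberTheory.GaloisRepresentations.GaloisRep
import Literature.RepresentationTheory.Semisimple.BurnsideMatrixSpan

/-!
# Trace limits VII — completeness tools: uniform limits of pseudocharacters over a complete
# `p`-adic field, limits in `ℂ_p`, and base change of irreducibility (route `PhantomRMYoshida`,
# crux `ResiduallyYoshidaLifting` = stmt-Langlands-13639, line `endoscopic-crossing-euler`, Stub 4)

Companion of `…TraceLimit{,Endo,Pseudo,Unique,Idempotent,Residual}.lean`
(`--supports stmt-Langlands-13639`).  The matched endoscopic components `tr a_n` of the approximants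
of Stub 4 are uniformly Cauchy (`…TraceLimitIdempotent`), but `ℚ̄_p = PadicAlgCl p` is not complete;
the endo-removal argument is finished in `ℂ_p = PadicComplex p`.  Tools, all proved:

* `exists_framedRep_of_uniform_limit_of_isPseudocharacter` — over ANY algebraically closed normed
  field `A` of characteristic `0`: a uniform `p`-adic limit `t` of continuous pseudocharacters of
  dimension `d` on a topological group is the trace of a continuous `r : G → GL_d(A)` (Taylor's
  theorem, tree `Hida2000_thm_2_18_1_holds`; continuity by `continuous_of_isSemisimple_of_continuous_trace`);
  the `ℚ̄_p`-only version is `exists_framedRep_of_uniform_limit` of `…TraceLimitPseudo`;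
* `exists_limit_padicComplex` (registered as `stub_endoComponentLimitInCp`) — a family of functions
  `x_n : G → ℚ̄_p` with `‖x_n - x_{n'}‖_∞ ≤ p⁻ⁿ` (`n ≤ n'`) has a uniform limit `t : G → ℂ_p` with
  `‖x_n - t‖_∞ ≤ p⁻ⁿ` (completeness of `ℂ_p`);
* `isIrreducible_map_of_isIrreducible` — irreducibility over an algebraically closed field is
  preserved by extension of scalars along any field homomorphism (Burnside, tree
  `span_eq_top_of_isIrreducible`, `span_range_map_eq_top_iff`, `isIrreducible_of_span_eq_top`).

References: R. Taylor, Duke Math. J. 63 (1991) §1; C. W. Curtis, I. Reiner (1962), (27.4).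
-/

noncomputable section

open Filter Topology
open scoped Matrix

namespace Summit.Langlands.Langlands.Cruxes.ResiduallyYoshidaLifting.EndoscopicCrossingEuler

set_option linter.dupNamespace false

open Literature.NumberTheory.GaloisRepresentations

variable {p : ℕ} [Fact p.Prime]

/-! ### Uniform limits of continuous pseudocharacters over a complete-or-not valued field -/

section Taylor

variable {A : Type} [NormedField A] [IsAlgClosed A] [CharZero A]
variable {G : Type} [Group G] [TopologicalSpace G] [IsTopologicalGroup G] {d : ℕ}

/-- `p⁻ᵐ → 0`. [folklore] -/
theorem tendsto_zpow_neg_natCast_nhds_zero' :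
    Tendsto (fun m : ℕ => (p : ℝ) ^ (-(m : ℤ))) atTop (𝓝 0) := by
  have h1 : (1 : ℝ) < p := by exact_mod_cast (Fact.out : p.Prime).one_lt
  have : (fun m : ℕ => (p : ℝ) ^ (-(m : ℤ))) = fun m : ℕ => ((p : ℝ)⁻¹) ^ m := by
    funext m
    rw [zpow_neg, zpow_natCast, inv_pow]
  rw [this]
  exact tendsto_pow_atTop_nhds_zero_of_lt_one (inv_nonneg.mpr (zero_le_one.trans h1.le))
    (inv_lt_one_of_one_lt₀ h1)

/-- **A uniform `p`-adic limit of continuous pseudocharacters is the trace of a continuous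
representation** (any algebraically closed normed field `A` of characteristic `0`, e.g. `ℂ_p`).  If
`F_m : G → A` are continuous pseudocharacters of dimension `d` with `‖F_m(g) - t(g)‖ ≤ p⁻ᵐ` for all
`m`, `g`, then `t = tr r` for a continuous `r : G → GL_d(A)`: `t` is a pseudocharacter
(tree `IsPseudocharacter.of_tendsto`), continuous (uniform limit), and Taylor's theorem applies
(tree `Hida2000_thm_2_18_1_holds`, `continuous_of_isSemisimple_of_continuous_trace`,
`ContinuousRep.frame`). [cite: Taylor1991, §1 Theorem 1] -/
theorem exists_framedRep_of_uniform_limit_of_isPseudocharacter (F : ℕ → G → A) (t : G → A)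
    (hps : ∀ m, IsPseudocharacter (F m) d) (hcont : ∀ m, Continuous (F m))
    (ht : ∀ (m : ℕ) (g : G), ‖F m g - t g‖ ≤ (p : ℝ) ^ (-(m : ℤ))) :
    ∃ r : FramedRep G A d, ∀ g, ((r g : GL (Fin d) A) : Matrix (Fin d) (Fin d) A).trace = t g := by
  classical
  -- `t` is a pseudocharacter of dimension `d`
  have hpt : Tendsto F atTop (𝓝 t) := by
    rw [tendsto_pi_nhds]
    intro g
    rw [tendsto_iff_norm_sub_tendsto_zero]
    exact squeeze_zero (fun m => norm_nonneg _) (fun m => ht m g) tendsto_zpow_neg_natCast_nhds_zero'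
  have hps' : IsPseudocharacter t d := IsPseudocharacter.of_tendsto (Eventually.of_forall hps) hpt
  -- `t` is continuous
  have hunif : TendstoUniformly F t atTop := by
    rw [Metric.tendstoUniformly_iff]
    intro ε hε
    obtain ⟨N, hN⟩ := (tendsto_order.1 (tendsto_zpow_neg_natCast_nhds_zero' (p := p))).2 ε hε
      |>.exists_forall_of_atTop
    refine eventually_atTop.mpr ⟨N, fun m hm g => ?_⟩
    rw [dist_comm, dist_eq_norm]
    exact (ht m g).trans_lt (hN m hm)
  have htc : Continuous t := hunif.continuous (Frequently.of_forall hcont)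
  -- Taylor's theorem
  obtain ⟨ρ, hss, htr⟩ := Hida2000_thm_2_18_1_holds G A d t hps'
  have hρc : Continuous fun q : G × (Fin d → A) => ρ q.1 q.2 := by
    refine continuous_of_isSemisimple_of_continuous_trace ρ hss (fun f => LinearMap.continuous_on_pi f) ?_
    simp only [htr]
    exact htc
  let ρc : ContinuousRep G A (Fin d → A) := ⟨ρ, hρc⟩
  refine ⟨ρc.frame (Pi.basisFun A (Fin d)), fun g => ?_⟩
  rw [ContinuousRep.coe_frame_apply, ← LinearMap.trace_eq_matrix_trace]
  exact htr g

end Taylor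

/-! ### Limits in `ℂ_p` -/

section Complete

/-- **Uniformly Cauchy families in `ℚ̄_p` converge uniformly in `ℂ_p`.**  If `x_n : G → ℚ̄_p` satisfy
`‖x_n(g) - x_{n'}(g)‖ ≤ p⁻ⁿ` for all `n ≤ n'` and `g`, there is `t : G → ℂ_p` with
`‖x_n(g) - t(g)‖ ≤ p⁻ⁿ` for all `n`, `g` (each `(x_n(g))_n` is Cauchy in the complete field `ℂ_p`,
Mathlib `cauchySeq_of_le_tendsto_0'`, `cauchySeq_tendsto_of_complete`; the bound passes to the
limit). [folklore] -/
theorem exists_limit_padicComplex {G : Type} (x : ℕ → G → PadicAlgCl p)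
    (h : ∀ (n n' : ℕ), n ≤ n' → ∀ g : G, ‖x n g - x n' g‖ ≤ (p : ℝ) ^ (-(n : ℤ))) :
    ∃ t : G → ℂ_[p], ∀ (n : ℕ) (g : G), ‖((x n g : PadicAlgCl p) : ℂ_[p]) - t g‖ ≤ (p : ℝ) ^ (-(n : ℤ)) := by
  have hlim : ∀ g : G, ∃ c : ℂ_[p], Tendsto (fun n => ((x n g : PadicAlgCl p) : ℂ_[p])) atTop (𝓝 c) := by
    intro g
    refine cauchySeq_tendsto_of_complete (cauchySeq_of_le_tendsto_0' (fun n => (p : ℝ) ^ (-(n : ℤ)))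
      (fun n m hnm => ?_) tendsto_zpow_neg_natCast_nhds_zero')
    rw [dist_eq_norm, ← UniformSpace.Completion.coe_sub, PadicComplex.norm_extends]
    exact h n m hnm g
  choose t ht using hlim
  refine ⟨t, fun n g => ?_⟩
  have hev : ∀ᶠ m in atTop, ‖((x n g : PadicAlgCl p) : ℂ_[p]) - ((x m g : PadicAlgCl p) : ℂ_[p])‖ ≤
      (p : ℝ) ^ (-(n : ℤ)) := by
    refine eventually_atTop.mpr ⟨n, fun m hm => ?_⟩
    rw [← UniformSpace.Completion.coe_sub, PadicComplex.norm_extends]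
    exact h n m hm g
  exact le_of_tendsto ((tendsto_const_nhds.sub (ht g)).norm) hev

/-- **Registered sub-goal `stub_endoComponentLimitInCp` of Stub 4** (the statement through which
this helper file lands, `--supports stmt-Langlands-13639`; = `exists_limit_padicComplex` in closed
form). [folklore] -/
theorem stub_endoComponentLimitInCp :
    ∀ (p : ℕ) [Fact p.Prime] (G : Type) (x : ℕ → G → PadicAlgCl p),
      (∀ (n n' : ℕ), n ≤ n' → ∀ g : G, ‖x n g - x n' g‖ ≤ (p : ℝ) ^ (-(n : ℤ))) →
      ∃ t : G → ℂ_[p], ∀ (n : ℕ) (g : G), ‖((x n g : PadicAlgCl p) : ℂ_[p]) - t g‖ ≤ (p : ℝ) ^ (-(n : ℤ)) :=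
  fun _ _ _ x h => exists_limit_padicComplex x h

end Complete

/-! ### Base change of irreducibility along a field homomorphism -/

section BaseChange

open Literature.RepresentationTheory.Semisimple

/-- **Irreducibility over an algebraically closed field survives extension of scalars**: if
`φ : Γ → GL_n(K)` is irreducible on `Kⁿ` (`K` algebraically closed, `n ≥ 1`) and `ι : K → L` is a
field homomorphism, `ι ∘ φ` is irreducible on `Lⁿ` (Burnside: the `φ(g)` span `M_n(K)`, hence the
`ι(φ g)` span `M_n(L)`). [folklore] -/
theorem isIrreducible_map_of_isIrreducible {K : Type} [Field K] [IsAlgClosed K] {L : Type} [Field L]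
    {Γ : Type} [Group Γ] {n : ℕ} (hn : 0 < n) (ι : K →+* L) (φ : Γ →* GL (Fin n) K)
    (h : Representation.IsIrreducible
      ((Representation.ofDistribMulAction K (GL (Fin n) K) (Fin n → K)).comp φ)) :
    Representation.IsIrreducible
      ((Representation.ofDistribMulAction L (GL (Fin n) L) (Fin n → L)).comp
        ((Matrix.GeneralLinearGroup.map ι).comp φ)) := by
  haveI : Representation.IsIrreducible ((glStdRepresentation (Fin n) K).comp φ) := h
  have hspan := span_eq_top_of_isIrreducible φ
  rw [← span_range_map_eq_top_iff ι] at hspan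
  exact isIrreducible_of_span_eq_top hn ((Matrix.GeneralLinearGroup.map ι).comp φ) hspan

end BaseChange

end Summit.Langlands.Langlands.Cruxes.ResiduallyYoshidaLifting.EndoscopicCrossingEuler

end
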